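/-
Copyright (c) 2026 the pub-hodgecm-mathlib formalisation cell (harness21).  Prover seat hodgecm-mathlib-LH4-p10 (g8) (valve hand on strike line L1, LEAD F0P6-plan
(g14) BATCH #172 (2), (ρ6a) (B-iii)): Track B «K2-LIT», hLiu418 = stmt-HodgeConjecture-24832 — FILE 1 of the Levi height square bound: the NAMED GAP «conjAdele-invariance
of the local ∕ arch heights», as an UPPER BOUND.  THEOREMS ONLY.
-/
import Summits.HodgeConjecture.HodgeConjecture.Theorems.K2LiuAdelicHeightGLVsVecHeight   -- ★ `vecFinHeight_one_entries_inv_eq_localHeight` (+ ★ `AdelicGLnGlue`, `AdelicHeightGLProofs`)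
import Literature.NumberTheory.Automorphic.AdelicVectorHeightGalois                       -- ★ `vecFinHeight_galSmul`
import Literature.NumberTheory.Automorphic.UnitaryGroupAutomorphicRep                      -- ★ `conjAdele`, `conjMixed`, `conjMixed_real_smul`, `continuous_conjMixed`
import HarnessLib

/-!
# Crux `HLiu418`, (ρ6a) height bricks, (B-iii) FILE 1: THE ADELIC HEIGHT OF `GL_n(𝔸_E)` UNDER THE CONJUGATION `c ⊗ 1` — `‖(c ⊗ 1) g‖ ≤ κ · ‖g‖`

Cell `hodgecm-mathlib`, crux item hLiu418 = `stmt-HodgeConjecture-24832`; squad K2, strike line L1; consumer = FILE 2 `K2LiuLeviHomHeightBound` ((B-iii): the Levi homomorphism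
`Λ g = R·diag(g, g♯)·R⁻¹` with `g♯ = T⁻¹·ᵗ((c ⊗ 1) g)⁻¹·T` — LEAD BATCH #172 (2) «conjAdele-invariance of local∕arch heights missing»), R90-C10-p03 (g0), p14 (P-dec).
Lane `--supports stmt-HodgeConjecture-24832 --as helper` (count-neutral).  THEOREMS ONLY (no `def`, no instance, no notation, no named-fact hypothesis, no `sorry`).

THE POINT.  The Borel–Jacquet height `‖g‖ = H_∞(g) · ∏_v H_v(g)` of ★ `AdelicGLnGlue` (`H = max` over the entries of `g` and `g⁻¹`) is compared along the Galois
conjugation `g ↦ (c ⊗ 1) g := GL.map (conjAdele F E c) g` (★ `conjAdele F E c x = c • x`):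
* §1 FINITE PLACES ARE PERMUTED EXACTLY: `H_v((c ⊗ 1) g) = H_{c⁻¹ v}(g)` (★ `vecFinHeight_one_entries_inv_eq_localHeight` turns `H_v` into the vector height
  `h_v(1, g, g⁻¹)`, ★ `vecFinHeight_galSmul` permutes it: `h_v(σ • x) = h_{σ⁻¹ v}(x)`), hence `∏_v H_v((c ⊗ 1) g) = ∏_v H_v(g)` (`finprod` over a bijection).
* §2 THE ARCHIMEDEAN HEIGHT UP TO A CONSTANT: `H_∞((c ⊗ 1) g) ≤ κ · H_∞(g)` with ONE `κ ≥ 0` for all `g` — the entries of `((c ⊗ 1) g)_∞^{±1}` are `(c ⊗ 1)`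
  (★ `conjMixed`) of those of `g_∞^{±1}` (★ `GLn.coe_toMixed_apply`, ★ `AdeleRing.smul_fst`, ★ `conjMixed_ringEquiv`), and `c ⊗ 1` is a bounded `ℝ`-linear operator on
  `E ⊗ ℝ` (★ `conjMixed_real_smul`, ★ `continuous_conjMixed`; the same 4-line operator-norm argument as ★ `K2E1CuspSiegelEstimatePrepU3.exists_norm_conjMixed_le`, kept as a
  `have` here to keep the import light).
* §3 **`exists_adelicHeightGL_map_conjAdele_le`** — `∃ κ ≥ 0, ∀ g, ‖(c ⊗ 1) g‖ ≤ κ · ‖g‖` (`n ≥ 1`).  (Equality holds — `c ⊗ 1` is a sup-norm isometry of `E ⊗ ℝ` —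
  but the consumer needs only the bound.)
HONEST LABEL.  Count-neutral helper: `HC_CM` is proved only modulo the 7 printed citations (2 remaining named inputs: hLiu418 = `stmt-HodgeConjecture-24832`,
h413 = `stmt-HodgeConjecture-24833`) until rung 0 closes.

## References
* [BorelJacquet1979] A. Borel, H. Jacquet, *Automorphic forms and automorphic representations*, Proc. Symp. Pure Math. 33 (1979), §1.2 (the height of `GL_n`).
* [MoeglinWaldspurger1995] C. Mœglin, J.-L. Waldspurger, *Spectral decomposition and Eisenstein series* (1995), I.2.2.
* [Godement1964] R. Godement, *Domaines fondamentaux des groupes arithmétiques*, Sém. Bourbaki 257 (1964), §1.1 (Galois invariance of heights).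
-/

set_option autoImplicit false
set_option linter.dupNamespace false -- the mandated namespace repeats `HodgeConjecture.HodgeConjecture`

noncomputable section

open scoped NNReal MatrixGroups Classical
open NumberField NumberField.mixedEmbedding IsDedekindDomain

namespace Summit.HodgeConjecture.HodgeConjecture.Cruxes.HLiu418.K2LiuAdelicHeightGLConjBound

open Literature.NumberTheory.Automorphic Literature.NumberTheory.Automorphic.UnitaryGroup
open Summit.HodgeConjecture.HodgeConjecture.Cruxes.HLiu418.K2LiuAdelicHeightGLVsVecHeight (vecFinHeight_one_entries_inv_eq_localHeight toMixed_inv_coe_apply)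

variable {F E : Type} [Field F] [Field E] [NumberField E] [Algebra F E] (c : E ≃ₐ[F] E) {n : ℕ}

/-! ## §1 Finite places: `H_v((c ⊗ 1) g) = H_{c⁻¹ v}(g)` and `∏_v H_v((c ⊗ 1) g) = ∏_v H_v(g)` -/

/-- the height vector `(1, (g_{ij}), ((g⁻¹)_{ik}))` of `(c ⊗ 1) g` is `c •` that of `g` (entrywise action; `(c ⊗ 1)(g⁻¹) = ((c ⊗ 1) g)⁻¹`, `c • 1 = 1`). [folklore] -/
theorem heightVector_map_conjAdele (g : GL (Fin n) (AdeleRing (𝓞 E) E)) :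
    (Sum.elim (fun o : Option (Fin n × Fin n) => o.elim 1 fun ij =>
        ((Matrix.GeneralLinearGroup.map (conjAdele F E c) g : GL (Fin n) (AdeleRing (𝓞 E) E)) : Matrix (Fin n) (Fin n) (AdeleRing (𝓞 E) E)) ij.1 ij.2)
      (fun ik : Fin n × Fin n => (((Matrix.GeneralLinearGroup.map (conjAdele F E c) g)⁻¹ : GL (Fin n) (AdeleRing (𝓞 E) E)) :
        Matrix (Fin n) (Fin n) (AdeleRing (𝓞 E) E)) ik.1 ik.2) : Option (Fin n × Fin n) ⊕ (Fin n × Fin n) → AdeleRing (𝓞 E) E) =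
      c • (Sum.elim (fun o : Option (Fin n × Fin n) => o.elim 1 fun ij => (g : Matrix (Fin n) (Fin n) (AdeleRing (𝓞 E) E)) ij.1 ij.2)
        (fun ik : Fin n × Fin n => ((g⁻¹ : GL (Fin n) (AdeleRing (𝓞 E) E)) : Matrix (Fin n) (Fin n) (AdeleRing (𝓞 E) E)) ik.1 ik.2) :
          Option (Fin n × Fin n) ⊕ (Fin n × Fin n) → AdeleRing (𝓞 E) E) := by
  funext i
  rw [Pi.smul_apply]
  rcases i with o | ik
  · rcases o with _ | ij
    · simp only [Sum.elim_inl, Option.elim, smul_one]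
    · simp only [Sum.elim_inl, Option.elim]
      rfl
  · simp only [Sum.elim_inr]
    rw [← map_inv]
    rfl

/-- **`H_v((c ⊗ 1) g) = H_{c⁻¹ v}(g)`** at every finite place (`n ≥ 1`). [cite: BorelJacquet1979, §1.2] [cite: Godement1964, §1.1] -/
theorem localHeight_map_conjAdele [NeZero n] (v : HeightOneSpectrum (𝓞 E)) (g : GL (Fin n) (AdeleRing (𝓞 E) E)) :
    GLn.localHeight n E v (Matrix.GeneralLinearGroup.map (conjAdele F E c) g) = GLn.localHeight n E (c⁻¹ • v) g := by
  rw [← vecFinHeight_one_entries_inv_eq_localHeight, ← vecFinHeight_one_entries_inv_eq_localHeight, heightVector_map_conjAdele c g,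
    vecFinHeight_galSmul]

/-- **`∏_v H_v((c ⊗ 1) g) = ∏_v H_v(g)`** (`n ≥ 1`; the places are permuted by `v ↦ c⁻¹ v`). [cite: BorelJacquet1979, §1.2] [cite: Godement1964, §1.1] -/
theorem finprod_localHeight_map_conjAdele [NeZero n] (g : GL (Fin n) (AdeleRing (𝓞 E) E)) :
    ∏ᶠ v, (GLn.localHeight n E v (Matrix.GeneralLinearGroup.map (conjAdele F E c) g) : ℝ) = ∏ᶠ v, (GLn.localHeight n E v g : ℝ) := by
  refine finprod_eq_of_bijective (fun v : HeightOneSpectrum (𝓞 E) => c⁻¹ • v) (MulAction.bijective c⁻¹) fun v => ?_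
  rw [localHeight_map_conjAdele]

/-! ## §2 The archimedean height: `H_∞((c ⊗ 1) g) ≤ κ · H_∞(g)` -/

/-- the archimedean entries of `(c ⊗ 1) g`: `((c ⊗ 1) g)_∞ = (c ⊗ 1)(g_∞)` entrywise. [folklore] -/
theorem coe_toMixed_map_conjAdele_apply (g : GL (Fin n) (AdeleRing (𝓞 E) E)) (i j : Fin n) :
    ((GLn.toMixed n E (Matrix.GeneralLinearGroup.map (conjAdele F E c) g) : GL (Fin n) (mixedSpace E)) : Matrix (Fin n) (Fin n) (mixedSpace E)) i j =
      conjMixed F E c (((GLn.toMixed n E g : GL (Fin n) (mixedSpace E)) : Matrix (Fin n) (Fin n) (mixedSpace E)) i j) := by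
  -- both sides are `ι ((c • g_{ij})_∞)` (★ `GLn.coe_toMixed_apply`, ★ `conjAdele_apply`, ★ `AdeleRing.smul_fst` are all `rfl`)
  show InfiniteAdeleRing.ringEquiv_mixedSpace E ((c • ((g : Matrix (Fin n) (Fin n) (AdeleRing (𝓞 E) E)) i j)).1) =
    conjMixed F E c (InfiniteAdeleRing.ringEquiv_mixedSpace E (((g : Matrix (Fin n) (Fin n) (AdeleRing (𝓞 E) E)) i j).1))
  rw [conjMixed_ringEquiv]
  rfl

/-- … and of its inverse. [folklore] -/
theorem coe_toMixed_map_conjAdele_inv_apply (g : GL (Fin n) (AdeleRing (𝓞 E) E)) (i j : Fin n) :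
    (((GLn.toMixed n E (Matrix.GeneralLinearGroup.map (conjAdele F E c) g))⁻¹ : GL (Fin n) (mixedSpace E)) : Matrix (Fin n) (Fin n) (mixedSpace E)) i j =
      conjMixed F E c ((((GLn.toMixed n E g)⁻¹ : GL (Fin n) (mixedSpace E)) : Matrix (Fin n) (Fin n) (mixedSpace E)) i j) := by
  rw [← map_inv, ← map_inv, ← map_inv, coe_toMixed_map_conjAdele_apply]

/-- **`H_∞((c ⊗ 1) g) ≤ κ · H_∞(g)`** with ONE `κ` for all `g ∈ GL_n(𝔸_E)`: `c ⊗ 1` is a bounded `ℝ`-linear operator on `E ⊗ ℝ`. [cite: BorelJacquet1979, §1.2]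
[cite: Godement1964, §1.1] -/
theorem exists_archHeight_map_conjAdele_le :
    ∃ κ : ℝ≥0, ∀ g : GL (Fin n) (AdeleRing (𝓞 E) E), GLn.archHeight n E (Matrix.GeneralLinearGroup.map (conjAdele F E c) g) ≤ κ * GLn.archHeight n E g := by
  -- `c ⊗ 1` as a continuous `ℝ`-linear map of `E ⊗ ℝ`; `κ` = its operator norm
  let Lc : mixedSpace E →L[ℝ] mixedSpace E :=
    { toFun := conjMixed F E c
      map_add' := map_add (conjMixed F E c)
      map_smul' := conjMixed_real_smul F E c
      cont := continuous_conjMixed F E c }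
  refine ⟨‖Lc‖₊, fun g => ?_⟩
  have hb : ∀ x : mixedSpace E, ‖conjMixed F E c x‖₊ ≤ ‖Lc‖₊ * ‖x‖₊ := fun x => Lc.le_opNNNorm x
  unfold GLn.archHeight
  refine Finset.sup_le fun ij _ => ?_
  rw [coe_toMixed_map_conjAdele_apply, coe_toMixed_map_conjAdele_inv_apply]
  have h1 : ‖(((GLn.toMixed n E g : GL (Fin n) (mixedSpace E)) : Matrix (Fin n) (Fin n) (mixedSpace E)) ij.1 ij.2)‖₊ ≤
      Finset.univ.sup fun ij : Fin n × Fin n => ‖((GLn.toMixed n E g : GL (Fin n) (mixedSpace E)) : Matrix (Fin n) (Fin n) (mixedSpace E)) ij.1 ij.2‖₊ ⊔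
        ‖(((GLn.toMixed n E g)⁻¹ : GL (Fin n) (mixedSpace E)) : Matrix (Fin n) (Fin n) (mixedSpace E)) ij.1 ij.2‖₊ :=
    le_sup_left.trans (Finset.le_sup (f := fun ij : Fin n × Fin n => ‖((GLn.toMixed n E g : GL (Fin n) (mixedSpace E)) : Matrix (Fin n) (Fin n) (mixedSpace E)) ij.1 ij.2‖₊ ⊔
        ‖(((GLn.toMixed n E g)⁻¹ : GL (Fin n) (mixedSpace E)) : Matrix (Fin n) (Fin n) (mixedSpace E)) ij.1 ij.2‖₊) (Finset.mem_univ ij))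
  have h2 : ‖((((GLn.toMixed n E g)⁻¹ : GL (Fin n) (mixedSpace E)) : Matrix (Fin n) (Fin n) (mixedSpace E)) ij.1 ij.2)‖₊ ≤
      Finset.univ.sup fun ij : Fin n × Fin n => ‖((GLn.toMixed n E g : GL (Fin n) (mixedSpace E)) : Matrix (Fin n) (Fin n) (mixedSpace E)) ij.1 ij.2‖₊ ⊔
        ‖(((GLn.toMixed n E g)⁻¹ : GL (Fin n) (mixedSpace E)) : Matrix (Fin n) (Fin n) (mixedSpace E)) ij.1 ij.2‖₊ :=
    le_sup_right.trans (Finset.le_sup (f := fun ij : Fin n × Fin n => ‖((GLn.toMixed n E g : GL (Fin n) (mixedSpace E)) : Matrix (Fin n) (Fin n) (mixedSpace E)) ij.1 ij.2‖₊ ⊔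
        ‖(((GLn.toMixed n E g)⁻¹ : GL (Fin n) (mixedSpace E)) : Matrix (Fin n) (Fin n) (mixedSpace E)) ij.1 ij.2‖₊) (Finset.mem_univ ij))
  exact sup_le ((hb _).trans (mul_le_mul' le_rfl h1)) ((hb _).trans (mul_le_mul' le_rfl h2))

/-! ## §3 The adelic height: `‖(c ⊗ 1) g‖ ≤ κ · ‖g‖` -/

/-- **`‖(c ⊗ 1) g‖ ≤ κ · ‖g‖`** for all `g ∈ GL_n(𝔸_E)`, `n ≥ 1`, with ONE `κ ≥ 0` (§1: the finite part is EQUAL; §2: the archimedean part up to `κ`).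
[cite: BorelJacquet1979, §1.2] [cite: MoeglinWaldspurger1995, I.2.2] [cite: Godement1964, §1.1] -/
theorem exists_adelicHeightGL_map_conjAdele_le [NeZero n] :
    ∃ κ : ℝ, 0 ≤ κ ∧ ∀ g : GL (Fin n) (AdeleRing (𝓞 E) E),
      adelicHeightGL n E (Matrix.GeneralLinearGroup.map (conjAdele F E c) g) ≤ κ * adelicHeightGL n E g := by
  obtain ⟨κ, hκ⟩ := exists_archHeight_map_conjAdele_le (F := F) (E := E) c (n := n)
  refine ⟨κ, κ.2, fun g => ?_⟩
  unfold adelicHeightGL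
  rw [finprod_localHeight_map_conjAdele, ← mul_assoc]
  refine mul_le_mul_of_nonneg_right ?_ (finprod_nonneg fun _ => NNReal.coe_nonneg _)
  exact_mod_cast hκ g

end Summit.HodgeConjecture.HodgeConjecture.Cruxes.HLiu418.K2LiuAdelicHeightGLConjBound

end
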